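import Mathlib
import Summits.ResolutionOfSingularities.ResolutionOfSingularities.Theses.PAlteration
import Summits.ResolutionOfSingularities.ResolutionOfSingularities.Theorems.PAlterationPicoverLocalModelCases
import Literature.AlgebraicGeometry.Resolution.ProjectiveSpaceRegular

/-!
# ResolutionOfSingularities / pAlteration — `Picover → PicoverLocalModel`
(supports stmt-ResolutionOfSingularities-0557)

Route `pAlteration`: the crux `PicoverLocalModel` (stmt-0557, rank 5) is the special case
`Y = Spec R`, `X = Spec ((R[T]/(T^p - a))_red)` of the crux `Picover` (stmt-0554, rank 2:
every integral scheme finite, universally injective and surjective over a regular integral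
separated `k`-scheme of finite type has a resolution). This file proves the implication
`Picover → PicoverLocalModel` by checking that the local model qualifies:

* `isFinite_localModel` — `X → Spec R` is finite (`(R[T]/(T^p - a))_red` is a finite `R`-module);
* `surjective_localModel` — it is surjective (lying over, `R ⊆ (R[T]/(T^p - a))_red` injective
  integral);
* `universallyInjective_localModel` — it is radicial (two `K`-points over the same `K`-point of
  `Spec R` agree: `p`-th roots are unique in fields of characteristic `p`);
* integrality of `X` is `isDomain_adjoinRoot_X_pow_sub_C_quotient_nilradical`
  (`PAlterationPicoverLocalModelCases`), regularity of `Spec R` is `Scheme.isRegular_Spec`.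

So closing `Picover` closes `PicoverLocalModel`; nothing here bears on `dim R ≥ 4` itself.
-/

-- `Summit.<Summit>.<Sub>.Theorems` with `Sub = Summit` (single-conjunct summit, D-0017): the
-- duplicated namespace component is the tree layout.
set_option linter.dupNamespace false

namespace Summit.ResolutionOfSingularities.ResolutionOfSingularities.Theorems

open Polynomial AlgebraicGeometry CategoryTheory Literature.AlgebraicGeometry.Resolution

universe u

/-! ## `Picover → PicoverLocalModel`: the local model is a finite radicial cover of `Spec R` -/

section OfPicover

variable {p : ℕ} [hp : Fact p.Prime] {R : Type u} [CommRing R]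

/-- The local model is **finite** over its base: `Spec ((R[T]/(T^p - a))_red) → Spec R` is a
finite morphism (`(R[T]/(T^p - a))_red` is a finite `R`-module). [folklore] -/
theorem isFinite_localModel (a : R) :
    IsFinite (Spec.map (CommRingCat.ofHom (algebraMap R
      (AdjoinRoot (X ^ p - C a) ⧸ nilradical (AdjoinRoot (X ^ p - C a)))))) := by
  rw [IsFinite.SpecMap_iff, CommRingCat.hom_ofHom, RingHom.finite_algebraMap]
  exact finite_adjoinRoot_X_pow_sub_C_quotient_nilradical a

/-- The local model **surjects onto its base**: `Spec ((R[T]/(T^p - a))_red) → Spec R` is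
surjective (lying over for the injective integral extension `R ⊆ (R[T]/(T^p - a))_red`).
[folklore] -/
theorem surjective_localModel [IsDomain R] (a : R) :
    Function.Surjective (Spec.map (CommRingCat.ofHom (algebraMap R
      (AdjoinRoot (X ^ p - C a) ⧸ nilradical (AdjoinRoot (X ^ p - C a)))))).base := by
  intro x
  have hint : (algebraMap R
      (AdjoinRoot (X ^ p - C a) ⧸ nilradical (AdjoinRoot (X ^ p - C a)))).IsIntegral :=
    RingHom.Finite.to_isIntegral
      (RingHom.finite_algebraMap.mpr (finite_adjoinRoot_X_pow_sub_C_quotient_nilradical a))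
  obtain ⟨y, hy⟩ := hint.comap_surjective (algebraMap_quotient_nilradical_injective a) x
  exact ⟨y, hy⟩

/-- The local model is **radicial** over its base: `Spec ((R[T]/(T^p - a))_red) → Spec R` is
universally injective — two `K`-points of the local model over the same `K`-point of `Spec R`
agree, because a `p`-th root of `a` in a field of characteristic `p` is unique. [folklore] -/
theorem universallyInjective_localModel [CharP R p] (a : R) :
    UniversallyInjective (Spec.map (CommRingCat.ofHom (algebraMap R
      (AdjoinRoot (X ^ p - C a) ⧸ nilradical (AdjoinRoot (X ^ p - C a)))))) := by
  refine ((tfae_universallyInjective (Spec.map (CommRingCat.ofHom (algebraMap R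
      (AdjoinRoot (X ^ p - C a) ⧸ nilradical (AdjoinRoot (X ^ p - C a))))))).out 1 0).mp ?_
  intro K _ g₁ g₂ h
  obtain ⟨φ₁, rfl⟩ := Spec.map_surjective g₁
  obtain ⟨φ₂, rfl⟩ := Spec.map_surjective g₂
  change Spec.map φ₁ ≫ _ = Spec.map φ₂ ≫ _ at h
  rw [← Spec.map_comp, ← Spec.map_comp] at h
  have h' := congrArg (fun ψ => ψ.hom) (Spec.map_injective h)
  simp only [CommRingCat.hom_comp, CommRingCat.hom_ofHom] at h'
  -- `h' : φ₁.hom.comp (algebraMap R _) = φ₂.hom.comp (algebraMap R _)`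
  have hchar : CharP K p := by
    refine (CharP.charP_iff_prime_eq_zero hp.out).mpr ?_
    have := congrArg (fun ψ : R →+* K => ψ (p : R)) h'
    simpa using (map_natCast (φ₁.hom.comp (algebraMap R _)) p).symm.trans
      (by rw [CharP.cast_eq_zero, map_zero])
  haveI := hchar
  haveI : ExpChar K p := ExpChar.prime hp.out
  congr 1
  ext : 1
  refine Ideal.Quotient.ringHom_ext (AdjoinRoot.ringHom_ext ?_ ?_)
  · ext r
    simpa [← Ideal.Quotient.mk_algebraMap, AdjoinRoot.algebraMap_eq] using congrArg (fun ψ => ψ r) h'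
  · apply frobenius_inj K p
    simp only [frobenius_def, RingHom.comp_apply, ← map_pow, root_X_pow_sub_C_pow]
    simpa [← Ideal.Quotient.mk_algebraMap, AdjoinRoot.algebraMap_eq] using congrArg (fun ψ => ψ a) h'

/-- **`Picover` implies `PicoverLocalModel`** (crux `stmt-ResolutionOfSingularities-0554` implies
crux `stmt-ResolutionOfSingularities-0557`): the local model `X_a = Spec ((R[T]/(T^p - a))_red)`
over a regular finitely generated `k`-domain `R` is an integral scheme, finite, universally
injective and surjective over the regular integral affine `k`-scheme of finite type `Spec R`, so
`PICover_p` resolves it. [folklore] -/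
theorem picoverLocalModel_of_picover
    (hP : Summit.ResolutionOfSingularities.ResolutionOfSingularities.Theses.PAlteration.Picover) :
    Summit.ResolutionOfSingularities.ResolutionOfSingularities.Theses.PAlteration.PicoverLocalModel := by
  unfold Summit.ResolutionOfSingularities.ResolutionOfSingularities.Theses.PAlteration.PicoverLocalModel
  intro p hp k _ _ R _ _ _ hft hreg a
  haveI : Fact p.Prime := ⟨hp⟩
  haveI : CharP R p := charP_of_algebra_field k R
  haveI := isDomain_adjoinRoot_X_pow_sub_C_quotient_nilradical (p := p) a
  haveI : IsRegularRing (CommRingCat.of R) := hreg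
  let f : Spec (.of R) ⟶ Spec (.of k) := Spec.map (CommRingCat.ofHom (algebraMap k R))
  haveI : LocallyOfFiniteType f :=
    (HasRingHomProperty.Spec_iff (P := @LocallyOfFiniteType)).mpr
      (RingHom.finiteType_algebraMap.mpr hft)
  exact hP p hp k (Spec (.of R)) (Spec (.of
      (AdjoinRoot (X ^ p - C a) ⧸ nilradical (AdjoinRoot (X ^ p - C a))))) f
    (Spec.map (CommRingCat.ofHom (algebraMap R _))) inferInstance inferInstance inferInstance
    inferInstance (Scheme.isRegular_Spec (.of R)) inferInstance (isFinite_localModel a)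
    (universallyInjective_localModel a) (surjective_localModel a)

end OfPicover

end Summit.ResolutionOfSingularities.ResolutionOfSingularities.Theorems
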